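import Literature.NumberTheory.Automorphic.BCDTModularityModPProofs
import Literature.NumberTheory.Automorphic.CDTModularityProofs
import Literature.NumberTheory.EllipticCurves.HasseWeilGoodReductionProofs
import Literature.NumberTheory.GaloisRepresentations.RamificationFiltrationProofs
import Literature.NumberTheory.GaloisRepresentations.OddAbsolutelyIrreducibleProofs
import Literature.NumberTheory.Automorphic.LanglandsTunnellModThree
import HarnessLib

/-!
# Breuil–Conrad–Diamond–Taylor, Theorem B (= Theorem 2.2.1) from its printed inputs

Topic `NumberTheory/Automorphic`; decomposition file for the named fact
`Literature.NumberTheory.Automorphic.BCDT.theoremB` of `Literature.NumberTheory.Automorphic.BCDTModularity`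
— C. Breuil, B. Conrad, F. Diamond, R. Taylor, *On the modularity of elliptic curves over `ℚ`: wild
3-adic exercises*, J. Amer. Math. Soc. 14 (2001), 843–939 [BCDTJAMS2001], **Theorem B** (p. 843) =
**Theorem 2.2.1** (§2.2): "Any continuous absolutely irreducible representation
`ρ̄ : G_ℚ → GL₂(𝔽₅)` with cyclotomic determinant is modular" — landed by the tenured seat of that
fact, following the architecture *printed* in §2.2 (proof of Thm. 2.2.1) and outlined in the
Introduction ("It thus only remained to prove Theorem B …").

## The printed proof (BCDT §2.2) and what this file does with each step

Let `ρ̄` be as in Theorem 2.2.1.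

1. *Local classification at `3`.* "Up to equivalence and twisting by a quadratic character",
   `ρ̄|_{G₃}` is (case 1) tamely ramified at `3`, or (cases 2–6) one of five explicit wild shapes.
   Tameness at `3` is invariant under quadratic twists, so the top-level case distinction is
   TAME / WILD above `3`; it is made here with the framed predicate
   `FramedGaloisRep.IsTamelyRamifiedAbove 3 ρ̄` (every wild ramification group `Γ_ℚ^u(𝔓)`, `u > 0`,
   `𝔓 ∣ 3`, maps to `1`; `isTamelyRamifiedAbove_iff_isTameAt` compares it with the tree's
   `GaloisRep.IsTameAt`).
2. *The auxiliary curve* ([Man] Thm. 5.3.2/§5.4, Cor. 2.3.2 for `E₁/ℚ₃`; then "Ekedahl's version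
   of the Hilbert Irreducibility Theorem and the argument of §1 of [SBT]"): an elliptic curve
   `E/ℚ` with `E[5] ≅ ρ̄`, `ρ̄_{E,3}` surjective onto `GL₂(𝔽₃)`, and `E[3]|_{G₃}` prescribed. The
   part of this that does not mention `3`-adic conditions is vendored as the named fact
   `exists_isTorsionGaloisRep_five_and_surjective_three` (also stated by Taylor, Pacific J. Math.
   1997, p. 344, and resting on Shepherd-Barron–Taylor 1997, §1).
3. *Case 1:* "`E` is modular by Theorem 7.2.1 of [CDT]" (CDT Prop. B.4.2: `E` acquires semistable
   reduction over a tame extension of `ℚ₃`, i.e. `27 ∤ N_E`). Vendored: `CDT_theorem_7_2_1`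
   (CDT 1999, p. 553; implied by the tree's `CDT_theorem_7_1_2`, `CDT_theorem_7_2_1_of_7_1_2`).
   PROVED here: `E[5] ≅ ρ̄` tame above `3` ⇒ `27 ∤ N_E`
   (`not_dvd_conductorNorm_of_isTamelyRamifiedAbove`, granted Ogg–Saito in Galois form at `ℓ = 5`,
   by the wild-ramification argument of `CDTModularityProofs`), and `ρ̄_{E,3}` surjective ⇒
   `ρ̄_{E,3}|_{ℚ(√-3)}` absolutely irreducible (`isAbsIrreducibleOverSqrt_neg_three_of_surjective`:
   the image of `Γ_{ℚ(√-3)}` contains the squares of `GL₂(𝔽₃)`, hence both unipotents, which have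
   no common eigenvector); so the tame case is a THEOREM
   (`exists_isTorsionGaloisRep_and_isModular_of_isTamelyRamifiedAbove`).
4. *Cases 2–6:* `ρ_{E,3}|_{G₃}` is potentially Barsotti–Tate of type `τ_{±1}`, `τ_{±3}`, `τ'_i`
   (CDT Prop. B.4.2); `τ` admits `ρ̄_{E,3}` and is weakly acceptable (Lemmas 2.1.1/2.1.3/2.1.5,
   Thms. 2.1.2/2.1.4/2.1.6 = §§3–9); Langlands–Tunnell; Thms. 1.4.1–1.4.2 ⇒ `ρ_{E,3}` modular ⇒
   `E` modular. This — the actual content of the paper, requiring `3`-adic Hodge types, "admits",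
   "weakly acceptable" and two `R = T` theorems, none of which is in Mathlib — is vendored as ONE
   named fact, `exists_isTorsionGaloisRep_and_isModular_of_not_isTamelyRamifiedAbove`.
5. *"We deduce that `E` is modular, so `ρ̄ ≅ ρ̄_{E,5}` is modular."* PROVED in the tree:
   `IsModular.isModular_of_isTorsionGaloisRep'` (`BCDTModularityModPProofs`) with its last input
   `trace_galoisRepTate_frobenius_of_hasGoodReductionAt_holds` (`HasseWeilGoodReductionProofs`);
   here `theoremB_of_exists_isTorsionGaloisRep_and_isModular`.

Assembled: `theoremB_of_wild_of_auxiliaryCurve_of_CDT721` (and `…_of_CDT712`), and Theorem A with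
Theorem B unfolded, `exists_isNewformOf_of_wild_of_auxiliaryCurve_of_CDT712_722`. Trust base of
`theoremB` inside the tree after this file: {Thm. 2.2.1 cases 2–6 (wild), the [SBT] auxiliary
curve, CDT Thm. 7.2.1 (or 7.1.2), Ogg–Saito for `V₅ E` at `3`}; of the Modularity Theorem
`exists_isNewformOf`: the same with CDT Thms. 7.1.2 and 7.2.2.

## Part 2 (appended). Theorem B as printed on p. 843; the tame cases `f = 1, 3, 9`

* *Theorem B (p. 843) versus Theorem 2.2.1.* The Introduction prints Theorem B with "irreducible",
  §2.2 prints Thm. 2.2.1 with "absolutely irreducible"; `theoremB` vendors the latter. Part 2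
  PROVES the two statements equivalent (`theoremB_iff_of_isIrreducible`): an odd irreducible
  `ρ̄ : Γ_ℚ → GL₂(𝔽₅)` is absolutely irreducible (`isAbsolutelyIrreducible_of_isIrreducible_of_det_eq`,
  the case `A = 𝔽₅`, `c` = complex conjugation of the tree's theorem
  `FramedRep.isAbsolutelyIrreducible_of_isIrreducible_of_det_eq_neg_one`,
  `OddAbsolutelyIrreducibleProofs`: a stable line over `B ⊇ 𝔽₅` is an eigenline of the
  involution `ρ̄(c)`, hence `𝔽₅`-rational).
* *The tame cases in the Introduction's terms.* BCDT's Introduction lists the cases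
  `f = 1, 3, 9, 27, 81, 243` ("`ρ̄` is unramified at `3`", "`ρ̄(I₃)` has order `5`", "order `4`",
  "order `12` …", "order `3`", "induced from …"); the tame case 1 of §2.2 comprises `f = 1, 3, 9`
  ("carried out in [Di2] in the cases `f = 1` and `f = 3`, and in [CDT] in the case `f = 9`"), the
  wild cases 2–6 of §2.2 are `f = 27, 81, 243`. Part 2 adds the API of `IsTamelyRamifiedAbove`
  making this usable: `isTamelyRamifiedAbove_conj_iff` (change of frame),
  `IsTorsionGaloisRep.isTamelyRamifiedAbove_iff` (for `E[n]` it is a property of the Galois module: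
  the wild groups fix `E[n]` pointwise), `isTamelyRamifiedAbove_of_coprime_card_map_inertia`
  (`#ρ̄(I_𝔓)` prime to `p` for all `𝔓 ∣ p` ⇒ tame: `Γ^u(𝔓) ≤ I_𝔓` and `ρ̄(Γ^u(𝔓))` is a `p`-group),
  and the corresponding corollaries of the tame-case theorem,
  `exists_isTorsionGaloisRep_and_isModular_of_isUnramifiedAt` (`f = 1`) and
  `exists_isTorsionGaloisRep_and_isModular_of_coprime_card_map_inertia` (`f = 3, 9`).
  (Part 2 also corrects one locator in the docstring of the wild fact: its cases are the
  Introduction's `f = 27, 81, 243`.)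

## Part 3 (appended). The Langlands–Tunnell step of §2.2 for the auxiliary curve

BCDT, §2.2, p. 862, on the auxiliary curve `E` (`E[5] ≅ ρ̄`, `ρ̄_{E,3}` surjective): *"Moreover
`ρ̄_{E,3}|_{Gal(ℚ̄/ℚ(√-3))}` is absolutely irreducible and, by the Langlands–Tunnell theorem (see
[Wi]), modular."*  The first clause is Part 1's `isAbsIrreducibleOverSqrt_neg_three_of_surjective`;
the second is now a THEOREM of the tree granted the named fact `langlands_tunnell` (lang.S30):
`WeierstrassCurve.isModular_of_isTorsionGaloisRep_three_of_langlands_tunnell` of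
`Automorphic/LanglandsTunnellModThree` (Wiles 1995, Ch. 5 = Gelbart 1997, Prop. 1.4, Steps 1–3:
the lift `Ψ : GL₂(𝔽₃) ↪ GL₂(ℤ[√-2])`, file `GaloisRepresentations/GL2F3Lift`; oddness from the Weil
pairing; a weight-one newform, reduced modulo a prime of `ℤ̄` above `(1 + √-2)`).  Part 3 records
the sentence as printed (`isAbsIrreducibleOverSqrt_and_isModular_three_of_surjective`) and the
auxiliary-curve fact with the Langlands–Tunnell step performed
(`exists_auxiliaryCurve_and_isModular_three`): granted [SBT] (`exists_isTorsionGaloisRep_five_and_surjective_three`)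
and `langlands_tunnell`, every `ρ̄` as in Theorem B is `E[5]` for an elliptic curve `E / ℚ` whose
`ρ̄_{E,3}` is surjective, absolutely irreducible on `ℚ(√-3)` and modular — i.e. all the hypotheses
on `ρ̄_{E,3}` of Thms. 1.4.1–1.4.2 and of CDT Thm. 7.2.1 other than the `3`-adic type conditions,
which remain inside the wild-case fact and `CDT_theorem_7_2_1`.  No new named fact.

## Faithfulness notes

* *Tame/wild instead of six cases.* BCDT normalise `ρ̄|_{G₃}` by a quadratic twist and list six
  shapes; shape 1 is "tamely ramified at `3`", shapes 2–6 are wildly ramified, and the order of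
  `ρ̄(I₃)` modulo powers of `3` is unchanged by a quadratic twist, so "case 1" is exactly
  `IsTamelyRamifiedAbove 3 ρ̄` for the original `ρ̄` and "cases 2–6" exactly its negation (all
  primes `𝔓 ∣ 3` of `ℚ̄` being conjugate). The five wild shapes themselves (characters of
  `ℚ₃(√-1)^×`, `ℚ₃(√±3)^×` via local class field theory) are not restated: they are internal to
  the wild case.
* *The auxiliary curve.* BCDT's `E` also carries a symplectic `ι : ρ̄ ≅ E[5]` and `3`-adic
  conditions; the vendored fact keeps only `E[5] ≅ ρ̄` (which is `W.IsTorsionGaloisRep 5 ρ̄`: `ρ̄`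
  is the matrix of `Γ_ℚ` on `E[5]` in some basis) and the surjectivity of `ρ̄_{E,3}` (for some,
  equivalently every, framed model of `E[3]`), i.e. it is implied by the printed assertion. It is
  stated for `ρ̄` absolutely irreducible with cyclotomic determinant, the standing hypotheses of
  §2.2 (Shepherd-Barron–Taylor need only the determinant condition).
* *CDT 7.2.1 versus 7.1.2.* BCDT cite Thm. 7.2.1, whose hypothesis "`ρ̄_{E,3}|_{ℚ(√-3)}` absolutely
  irreducible" is supplied by the surjectivity of `ρ̄_{E,3}`; CDT's Thm. 7.1.2 drops that
  hypothesis (it is deduced from 7.2.1, Lemma 7.2.3 and the `3`–`5` switch), so either fact closes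
  the tame case; both assemblies are given.
* *Ogg–Saito.* "`ρ̄_{E,5}` tame at `3` ⇒ `27 ∤ N_E`" is, in CDT and BCDT, read off Prop. B.4.2
  (`E` acquires semistable reduction over `ℚ₃(E[5])`); here it is proved from the conductor side:
  `27 ∣ N_E` forces Swan conductor at `3` of `V₅ E`, hence a wild element acting non-trivially on
  `V₅ E`, hence (orders coprime to `5`) on `E[5]`. The input is the tree's named fact
  `WeierstrassCurve.artinConductorExponent_tate_eq_conductorExponent_of_isElliptic W 5`
  (Serre–Tate 1968 §2.1; Silverman *ATAEC* IV.10.2, IV.11.1), already in the trust base of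
  Theorem A (`CDTModularityProofs`).
* `ModPGaloisRep.IsModular`, `Literature.NumberTheory.Automorphic.BCDT.IsModular`, `IsTorsionGaloisRep`,
  `IsAbsIrreducibleOverSqrt` are those of `BCDTModularity` (see the faithfulness notes there).

## Mathlib / tree search

Mathlib (pin v4.32.0) has no modular curves, no Hilbert irreducibility, no Galois representations
of elliptic curves beyond torsion points, no ramification filtration in upper numbering (grep
`HilbertIrreducib`, `upperRamification`, `ModularCurve`: no hits). Reused from the tree:
`absUpperRamificationSubgroup`, `GaloisRep.IsTameAt`, `absUpperRamificationSubgroup_le_inertia_holds`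
(`RamificationFiltration*`), the wild-ramification lemmas `exists_mem_absUpperRamificationSubgroup_ne_one`,
`exists_pow_prime_pow_smul_eq_self`, `smul_eq_self_of_pow_smul_eq_self_of_coprime`,
`exists_smul_proj_ne_of_ne_one` and `EllipticCurves.inv_mul_mem_range_absGaloisRestrict`
(`CDTModularityProofs`, `ZpExtensionProofs`), the Tate-module facts `…_holds` of
`TateModule*Proofs`, `factorization_conductorNorm_holds`, `conductorNorm_pos_holds`.

## References

* [BCDTJAMS2001] Breuil–Conrad–Diamond–Taylor, JAMS 14 (2001): Thm. B (p. 843), Introduction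
  (strategy, cases `f = 1, …, 243`, "`ρ̄_{E,3}` is surjective onto `GL₂(𝔽₃)`"), §1.4 (Thms. 1.4.1,
  1.4.2), §2.1 (Lemmas 2.1.1/2.1.3/2.1.5, Thms. 2.1.2/2.1.4/2.1.6), §2.2 (Thm. 2.2.1 and its proof,
  Thm. 2.2.2), §2.3 (Cor. 2.3.2).
* [ConradDiamondTaylor1999] Conrad–Diamond–Taylor, JAMS 12 (1999): Introduction (p. 522),
  Thm. 7.2.1 (p. 553), Thm. 7.1.2, Thm. 7.2.2, proof of Thm. 7.1.2 (p. 556), Prop. B.4.2 (p. 564).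
* N. I. Shepherd-Barron, R. Taylor, *Mod 2 and mod 5 icosahedral representations*, JAMS 10 (1997),
  283–298, §1.
* R. Taylor, *Icosahedral Galois representations*, Pacific J. Math. (1997), Olga Taussky-Todd
  memorial issue, 337–347, p. 344.
* J. Manoharmayum, *Pairs of mod 3 and mod 5 representations arising from elliptic curves*,
  Math. Res. Lett. 6 (1999), 735–754, Thm. A and Corollary (pp. 736–737), Thm. 5.3.2, §5.4.
* T. Ekedahl, *An effective version of Hilbert's irreducibility theorem*, Sém. Théorie des Nombres
  Paris 1988–89, Thm. 1.3.
* [SerreLocalFields1979] J.-P. Serre, *Local Fields*, Ch. IV §3 (upper numbering).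

## Design

New definitions: the framed predicate `FramedGaloisRep.IsTamelyRamifiedAbove` (deliberate
dot-notation extension of the tree's `FramedGaloisRep`, directory `GaloisRepresentations`, with
the comparison lemma `isTamelyRamifiedAbove_iff_isTameAt` and `isTamelyRamifiedAbove_of_isUnramifiedAt`)
and three named facts (`CDT_theorem_7_2_1`, `exists_isTorsionGaloisRep_five_and_surjective_three`,
`exists_isTorsionGaloisRep_and_isModular_of_not_isTamelyRamifiedAbove`); everything else is a
theorem. `noncomputable section`; namespace `Literature.NumberTheory.Automorphic.BCDT` (next to the
facts it serves); no instances, no `sorry`. Axioms of every theorem: `propext`, `Classical.choice`,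
`Quot.sound`.
-/

noncomputable section

open scoped NumberField MatrixGroups Polynomial
open Field IsDedekindDomain Matrix Polynomial

universe u

namespace Literature.NumberTheory.Automorphic.BCDT

/-! ## Quadratic fields `ℚ(√d)` -/

section Sqrt

/-- `X² - d` is irreducible over `ℚ` when `d` is not a rational square. [folklore] -/
theorem irreducible_X_pow_two_sub_C {d : ℚ} (hd : ¬ IsSquare d) : Irreducible (X ^ 2 - C d) :=
  X_pow_sub_C_irreducible_of_prime Nat.prime_two fun b hb ↦ hd ⟨b, by rw [← pow_two, hb]⟩

/-- `-3` is not a rational square. [folklore] -/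
theorem not_isSquare_neg_three : ¬ IsSquare (-3 : ℚ) := fun ⟨r, hr⟩ ↦ by
  nlinarith [mul_self_nonneg r]

variable {d : ℚ} (hd : ¬ IsSquare d) (L : Type*) [Field L] [Algebra ℚ L]
  [IsSplittingField ℚ L (X ^ 2 - C d)]

include hd in
/-- A splitting field of `X² - d` over `ℚ`, `d` a non-square, has degree `2` (the case `d = 5` is
`finrank_eq_two_of_isSplittingField` of `CDTModularityProofs`; same proof). [folklore] -/
theorem finrank_eq_two_of_isSplittingField_X_pow_two_sub_C : Module.finrank ℚ L = 2 := by
  set p : ℚ[X] := X ^ 2 - C d with hp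
  have hp0 : p ≠ 0 := (irreducible_X_pow_two_sub_C hd).ne_zero
  have hmonic : p.Monic := by rw [hp]; exact monic_X_pow_sub_C _ two_ne_zero
  have hdeg : p.natDegree = 2 := by rw [hp]; exact natDegree_X_pow_sub_C
  haveI : FiniteDimensional ℚ L := IsSplittingField.finiteDimensional L p
  haveI : Algebra.IsIntegral ℚ L := Algebra.IsIntegral.of_finite ℚ L
  have hsplit := IsSplittingField.splits L p
  obtain ⟨α, hα⟩ : ∃ α : L, aeval α p = 0 := by
    have hd' : (p.map (algebraMap ℚ L)).degree ≠ 0 := by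
      rw [degree_map, degree_eq_natDegree hp0, hdeg]; decide
    obtain ⟨α, hα⟩ := hsplit.exists_eval_eq_zero hd'
    exact ⟨α, by rwa [aeval_def, eval₂_eq_eval_map]⟩
  have hα2 : α ^ 2 = algebraMap ℚ L d := by
    have := hα; rw [hp, map_sub, map_pow, aeval_X, aeval_C, sub_eq_zero] at this
    exact this
  have hroots : p.rootSet L ⊆ (IntermediateField.adjoin ℚ {α} : Set L) := by
    intro β hβ
    rw [mem_rootSet] at hβ
    have hβ2 : β ^ 2 = algebraMap ℚ L d := by
      have := hβ.2; rw [hp, map_sub, map_pow, aeval_X, aeval_C, sub_eq_zero] at this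
      exact this
    have hαmem : α ∈ IntermediateField.adjoin ℚ {α} := IntermediateField.mem_adjoin_simple_self ℚ α
    have : (β - α) * (β + α) = 0 := by ring_nf; rw [hβ2, hα2]; ring
    rcases mul_eq_zero.mp this with h | h
    · rw [sub_eq_zero.mp h]; exact hαmem
    · rw [eq_neg_of_add_eq_zero_left h]; exact neg_mem hαmem
  have htop : IntermediateField.adjoin ℚ {α} = ⊤ := by
    rw [← IntermediateField.toSubalgebra_injective.eq_iff, IntermediateField.top_toSubalgebra,
      ← IsSplittingField.adjoin_rootSet L p]
    refine le_antisymm ?_ (Algebra.adjoin_le hroots)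
    rw [IntermediateField.adjoin_simple_toSubalgebra_of_isAlgebraic
      (Algebra.IsAlgebraic.isAlgebraic α)]
    refine Algebra.adjoin_mono ?_
    rw [Set.singleton_subset_iff, mem_rootSet]
    exact ⟨hp0, hα⟩
  have hmin : minpoly ℚ α = p := (minpoly.eq_of_irreducible_of_monic
    (irreducible_X_pow_two_sub_C hd) hα hmonic).symm
  rw [← IntermediateField.finrank_top', ← htop,
    IntermediateField.adjoin.finrank (Algebra.IsIntegral.isIntegral α), hmin, hdeg]

include hd in
/-- For `[L : ℚ] = 2` the image of `Γ_L → Γ_ℚ` has index `≤ 2`, so it contains all squares.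
[folklore] -/
theorem sq_mem_range_absGaloisRestrict_of_isSplittingField (g : absoluteGaloisGroup ℚ) :
    g ^ 2 ∈ Set.range (GaloisRepresentations.absGaloisRestrict ℚ L) := by
  haveI : FiniteDimensional ℚ L := IsSplittingField.finiteDimensional L (X ^ 2 - C d)
  by_cases hg : g ∈ Set.range (GaloisRepresentations.absGaloisRestrict ℚ L)
  · obtain ⟨x, rfl⟩ := hg
    exact ⟨x ^ 2, map_pow _ _ _⟩
  · have hg' : g⁻¹ ∉ Set.range (GaloisRepresentations.absGaloisRestrict ℚ L) := by
      rintro ⟨x, hx⟩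
      exact hg ⟨x⁻¹, by rw [map_inv, hx, inv_inv]⟩
    have := EllipticCurves.inv_mul_mem_range_absGaloisRestrict
      (finrank_eq_two_of_isSplittingField_X_pow_two_sub_C hd L) hg' hg
    rwa [inv_inv, ← pow_two] at this

end Sqrt

/-! ## Surjective mod-3 representations are absolutely irreducible on quadratic fields -/


/-- The upper unipotent `(1 1; 0 1) ∈ GL₂(𝔽₃)` is a square, namely of `(1 2; 0 1)`. [folklore] -/
theorem exists_sq_eq_upper_unipotent :
    ∃ u : GL (Fin 2) (ZMod 3),
      ((u ^ 2 : GL (Fin 2) (ZMod 3)) : Matrix (Fin 2) (Fin 2) (ZMod 3)) = !![1, 1; 0, 1] :=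
  ⟨⟨!![1, 2; 0, 1], !![1, 1; 0, 1], by decide, by decide⟩, by
    rw [Units.val_pow_eq_pow_val]; decide⟩

/-- The lower unipotent `(1 0; 1 1) ∈ GL₂(𝔽₃)` is a square, namely of `(1 0; 2 1)`. [folklore] -/
theorem exists_sq_eq_lower_unipotent :
    ∃ u : GL (Fin 2) (ZMod 3),
      ((u ^ 2 : GL (Fin 2) (ZMod 3)) : Matrix (Fin 2) (Fin 2) (ZMod 3)) = !![1, 0; 1, 1] :=
  ⟨⟨!![1, 0; 2, 1], !![1, 0; 1, 1], by decide, by decide⟩, by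
    rw [Units.val_pow_eq_pow_val]; decide⟩

/-- An eigenvector of the upper unipotent `(1 1; 0 1)` over a field has vanishing second
coordinate. [folklore] -/
theorem apply_one_eq_zero_of_upper_unipotent_mulVec {B : Type*} [Field B] (f : ZMod 3 →+* B)
    {v : Fin 2 → B} {μ : B}
    (h : (!![1, 1; 0, 1] : Matrix (Fin 2) (Fin 2) (ZMod 3)).map f *ᵥ v = μ • v) : v 1 = 0 := by
  have h0 := congrFun h 0
  have h1 := congrFun h 1
  simp [Matrix.mulVec, dotProduct, Fin.sum_univ_two, Matrix.map_apply] at h0 h1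
  by_contra hv1
  have hμ : μ = 1 := by
    have h1' : 1 * v 1 = μ * v 1 := by rw [one_mul]; exact h1
    exact (mul_right_cancel₀ hv1 h1').symm
  rw [hμ, one_mul] at h0
  exact hv1 (by linear_combination h0)

/-- An eigenvector of the lower unipotent `(1 0; 1 1)` over a field has vanishing first
coordinate. [folklore] -/
theorem apply_zero_eq_zero_of_lower_unipotent_mulVec {B : Type*} [Field B] (f : ZMod 3 →+* B)
    {v : Fin 2 → B} {μ : B}
    (h : (!![1, 0; 1, 1] : Matrix (Fin 2) (Fin 2) (ZMod 3)).map f *ᵥ v = μ • v) : v 0 = 0 := by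
  have h0 := congrFun h 0
  have h1 := congrFun h 1
  simp [Matrix.mulVec, dotProduct, Fin.sum_univ_two, Matrix.map_apply] at h0 h1
  by_contra hv0
  have hμ : μ = 1 := by
    have h0' : 1 * v 0 = μ * v 0 := by rw [one_mul]; exact h0
    exact (mul_right_cancel₀ hv0 h0').symm
  rw [hμ, one_mul] at h1
  exact hv0 (by linear_combination h1)

/-- **A surjective `ρ̄ : Γ_ℚ → GL₂(𝔽₃)` is absolutely irreducible on `Γ_{ℚ(√-3)}`** (indeed on
`Γ_L` for any quadratic field `L`): the image of `Γ_L` contains the squares of `GL₂(𝔽₃)`, in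
particular the unipotents `(1 1; 0 1) = (1 2; 0 1)²` and `(1 0; 1 1) = (1 0; 2 1)²`, which have
no common eigenvector over any field `B ⊇ 𝔽₃`. (BCDT, Introduction and §2.2: the auxiliary
curve has "`ρ̄_{E,3}` surjective onto `GL₂(𝔽₃)`", whence "`ρ̄_{E,3}|_{Gal(ℚ̄/ℚ(√-3))}` is
absolutely irreducible".) [folklore] -/
theorem isAbsIrreducibleOverSqrt_neg_three_of_surjective
    (ρ : GaloisRepresentations.ModPGaloisRep ℚ (ZMod 3) 2) (hsurj : Function.Surjective ρ) :
    ρ.IsAbsIrreducibleOverSqrt (-3) := by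
  intro L _ _ _ B _ f
  classical
  set r := GaloisRepresentations.absGaloisRestrict ℚ L with hr
  set ρ' := (GaloisRepresentations.FramedGaloisRep.restrictField L ρ).baseChangeRepresentation f
    with hρ'def
  have hρ' : ∀ (g : absoluteGaloisGroup L) (v : Fin 2 → B),
      ρ' g v = ((ρ (r g) : GL (Fin 2) (ZMod 3)) : Matrix (Fin 2) (Fin 2) (ZMod 3)).map f *ᵥ v := by
    intro g v
    rw [hρ'def, GaloisRepresentations.FramedRep.baseChangeRepresentation_apply_apply,
      GaloisRepresentations.FramedGaloisRep.restrictField_apply]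
    rfl
  -- squares of `Γ_ℚ` restrict from `Γ_L`; the two unipotents lie in `ρ̄(Γ_L)`
  have hsq : ∀ u : GL (Fin 2) (ZMod 3), ∃ g : absoluteGaloisGroup L, ρ (r g) = u ^ 2 := by
    intro u
    obtain ⟨g₀, hg₀⟩ := hsurj u
    obtain ⟨g, hg⟩ := sq_mem_range_absGaloisRestrict_of_isSplittingField not_isSquare_neg_three L g₀
    exact ⟨g, by change ρ (GaloisRepresentations.absGaloisRestrict ℚ L g) = u ^ 2; rw [hg, map_pow, hg₀]⟩
  obtain ⟨u₁, hu₁⟩ := exists_sq_eq_upper_unipotent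
  obtain ⟨u₂, hu₂⟩ := exists_sq_eq_lower_unipotent
  obtain ⟨g₁, hg₁⟩ := hsq u₁
  obtain ⟨g₂, hg₂⟩ := hsq u₂
  -- non-triviality of the lattice of subrepresentations
  haveI : Nontrivial (Subrepresentation ρ') := by
    refine ⟨⟨⊥, ⊤, fun h ↦ ?_⟩⟩
    have h' := congrArg Subrepresentation.toSubmodule h
    exact bot_ne_top (α := Submodule B (Fin 2 → B)) h'
  refine ⟨fun S ↦ ?_⟩
  rcases eq_or_ne S ⊥ with h | hSbot
  · exact Or.inl h
  rcases eq_or_ne S ⊤ with h | hStop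
  · exact Or.inr h
  exfalso
  -- `S` is a line `B ∙ v`
  set U : Submodule B (Fin 2 → B) := S.toSubmodule with hU
  have hUbot : U ≠ ⊥ := fun h ↦ hSbot (Subrepresentation.toSubmodule_injective h)
  have hUtop : U ≠ ⊤ := fun h ↦ hStop (Subrepresentation.toSubmodule_injective h)
  have hU1 : Module.finrank B U = 1 := by
    have hlt : Module.finrank B U < Module.finrank B (Fin 2 → B) := Submodule.finrank_lt hUtop
    have hpos : Module.finrank B U ≠ 0 := fun h ↦ hUbot (Submodule.finrank_eq_zero.mp h)
    have hfin2 : Module.finrank B (Fin 2 → B) = 2 := by simp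
    omega
  obtain ⟨v, hvU, hv⟩ := Submodule.exists_mem_ne_zero_of_ne_bot hUbot
  have hUspan : U = B ∙ v := by
    refine (Submodule.eq_of_le_of_finrank_eq ((Submodule.span_singleton_le_iff_mem v U).mpr hvU)
      ?_).symm
    rw [finrank_span_singleton hv, hU1]
  -- `v` is a common eigenvector of `ρ̄(Γ_L)`
  have heig : ∀ g : absoluteGaloisGroup L, ∃ μ : B,
      ((ρ (r g) : GL (Fin 2) (ZMod 3)) : Matrix (Fin 2) (Fin 2) (ZMod 3)).map f *ᵥ v = μ • v := by
    intro g
    have hmem : ρ' g v ∈ U := S.apply_mem_toSubmodule g hvU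
    rw [hρ', hUspan, Submodule.mem_span_singleton] at hmem
    obtain ⟨μ, hμ⟩ := hmem
    exact ⟨μ, hμ.symm⟩
  obtain ⟨μ₁, hμ₁⟩ := heig g₁
  obtain ⟨μ₂, hμ₂⟩ := heig g₂
  rw [hg₁, hu₁] at hμ₁
  rw [hg₂, hu₂] at hμ₂
  have h1 := apply_one_eq_zero_of_upper_unipotent_mulVec f hμ₁
  have h0 := apply_zero_eq_zero_of_lower_unipotent_mulVec f hμ₂
  apply hv
  ext i
  fin_cases i
  · exact h0
  · exact h1

/-! ## Tame ramification of a framed Galois representation above a rational prime -/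

/-- **`ρ` is tamely ramified above the rational prime `p`** (for a framed Galois representation
`ρ : Γ_K →ₜ* GL_n(A)` of a number field `K`): for every finite place `v ∣ p` of `K`, every prime
`𝔓` of `\bar ℤ_K` above `v`, and every `u > 0`, the wild ramification group
`Γ_K^u(𝔓) = absUpperRamificationSubgroup (𝓞 K) 𝔓 u` (absolute upper numbering, Serre *Corps
locaux* IV §3) maps to `1 ∈ GL_n(A)`; equivalently the wild inertia groups `P_𝔓`, `𝔓 ∣ p`, act
trivially, i.e. `ρ(I_𝔓)` has order prime to `p` when the image is finite. This is the framed form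
(no topological-ring hypothesis, like `FramedGaloisRep.IsUnramifiedAt`) of the tree's
`GaloisRep.IsTameAt (𝓞 K) 𝔓 ρ.toGaloisRep` for all `𝔓 ∣ p`
(`isTamelyRamifiedAbove_iff_isTameAt`). BCDT, Introduction and §2.2, case 1: "`ρ̄` is tamely
ramified at `3`" (resp. "unramified at `3`", resp. "`ρ̄(I₃)` has order `5`, `4`, …"). Deliberate
dot-notation extension of the tree's `FramedGaloisRep` (directory `GaloisRepresentations`).
[cite: BCDTJAMS2001, §2.2 (proof of Thm. 2.2.1, case 1)] -/
def _root_.Literature.NumberTheory.GaloisRepresentations.FramedGaloisRep.IsTamelyRamifiedAbove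
    {K : Type*} [Field K] [NumberField K] {A : Type*} [CommRing A] [TopologicalSpace A] {n : ℕ}
    (p : ℕ) (ρ : GaloisRepresentations.FramedGaloisRep K A n) : Prop :=
  ∀ v : HeightOneSpectrum (𝓞 K), (p : 𝓞 K) ∈ v.asIdeal → ∀ 𝔓 ∈ v.primesAbove,
    ∀ u : ℝ, 0 < u → ∀ σ ∈ GaloisRepresentations.absUpperRamificationSubgroup (𝓞 K) 𝔓 u, ρ σ = 1

/-- `FramedGaloisRep.IsTamelyRamifiedAbove p` agrees with `GaloisRep.IsTameAt` of the associated
representation on `Fin n → A` at every prime `𝔓 ∣ p` (the standard representation of `GL_n(A)`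
is faithful). [folklore] -/
theorem _root_.Literature.NumberTheory.GaloisRepresentations.FramedGaloisRep.isTamelyRamifiedAbove_iff_isTameAt
    {K : Type*} [Field K] [NumberField K] {A : Type*} [CommRing A] [TopologicalSpace A]
    [IsTopologicalRing A] {n : ℕ} (p : ℕ) (ρ : GaloisRepresentations.FramedGaloisRep K A n) :
    ρ.IsTamelyRamifiedAbove p ↔
      ∀ v : HeightOneSpectrum (𝓞 K), (p : 𝓞 K) ∈ v.asIdeal → ∀ 𝔓 ∈ v.primesAbove,
        ρ.toGaloisRep.IsTameAt (𝓞 K) 𝔓 := by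
  refine forall₂_congr fun v _ ↦ forall₂_congr fun 𝔓 _ ↦ forall₂_congr fun u _ ↦
    forall₂_congr fun σ _ ↦ ?_
  change ρ σ = 1 ↔ GaloisRepresentations.FramedRep.toRepresentation ρ σ = 1
  constructor
  · intro h
    refine LinearMap.ext fun w ↦ ?_
    simp [h]
  · intro h
    have h1 : Matrix.toLin' ((ρ σ : GL (Fin n) A) : Matrix (Fin n) (Fin n) A) =
        Matrix.toLin' 1 := by
      rw [Matrix.toLin'_one]
      refine LinearMap.ext fun w ↦ ?_
      simpa using congr($h w)
    exact Units.ext (Matrix.toLin'.injective h1)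

/-- A representation unramified at every place above `p` (BCDT, Introduction, the case `f = 1`:
"`ρ̄` is unramified at `3`") is tamely ramified above `p`: `Γ_K^u(𝔓) ≤ I_𝔓` (the tree's theorem
`absUpperRamificationSubgroup_le_inertia_holds`, Serre *Corps locaux* IV §3). [folklore] -/
theorem _root_.Literature.NumberTheory.GaloisRepresentations.FramedGaloisRep.isTamelyRamifiedAbove_of_isUnramifiedAt
    {K : Type*} [Field K] [NumberField K] {A : Type*} [CommRing A] [TopologicalSpace A] {n : ℕ}
    {p : ℕ} {ρ : GaloisRepresentations.FramedGaloisRep K A n}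
    (h : ∀ v : HeightOneSpectrum (𝓞 K), (p : 𝓞 K) ∈ v.asIdeal → ρ.IsUnramifiedAt v) :
    ρ.IsTamelyRamifiedAbove p :=
  fun v hv 𝔓 h𝔓 u _ σ hσ ↦ h v hv 𝔓 h𝔓 σ
    (GaloisRepresentations.absUpperRamificationSubgroup_le_inertia_holds (𝓞 K) 𝔓 u (K := K) hσ)

/-! ## Elliptic curves over `ℚ`: `27 ∣ N_E` forces wild ramification of `E[5]` above `3` -/

open WeierstrassCurve in
/-- **`27 ∣ N_E` ⇒ `E[5]` is wildly ramified above `3`** — granted Ogg–Saito in Galois form at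
`ℓ = 5` (the tree's named fact
`WeierstrassCurve.artinConductorExponent_tate_eq_conductorExponent_of_isElliptic W 5`, Serre–Tate
1968 §2.1, Silverman *ATAEC* IV.10.2/IV.11.1). For an elliptic curve `E / ℚ` with `27 ∣ N_E` and
any framed model `ρ̄` of `E[5]`, some element `σ` of some wild ramification group `Γ_ℚ^u(𝔓)`
(`u > 0`, `𝔓` a prime of `ℚ̄` above `3`) has `ρ̄(σ) ≠ 1`. This is the contrapositive of the remark
used by CDT and BCDT to pass from "`ρ̄_{E,5}` tamely ramified at `3`" to "`27 ∤ N_E`" (CDT 1999,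
Introduction, p. 522: the hypothesis `27 ∤ N_E` "is satisfied if and only if `E` acquires
semistable reduction over a tamely ramified extension of `ℚ₃`"; BCDT 2001, Introduction: "in both
cases `E` obtains semi-stable reduction over a tame extension of `ℚ_ℓ`"). Proof (the arithmetic
half of `exists_orderOf_eq_three_of_dvd_conductorNorm`, `CDTModularityProofs`, stopped one step
earlier): `27 ∣ N_E` means `f₃(E) ≥ 3`, so `a₃(V₅ E) = codim (V₅ E)^{I} + Sw ≥ 3 > 2 = dim V₅ E`
and some `σ ∈ Γ_ℚ^u(𝔓)`, `u > 0`, acts non-trivially on `V₅ E`, hence moves a point of some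
`E[5ⁿ]`; its action on the finite `Γ_ℚ`-set `E[5ⁿ]` has `3`-power order (`Γ_ℚ^u ↠ Gal(L/ℚ)^u ≤ G₁`,
a `3`-group), so by coprimality it already moves a point of `E[5]`, i.e. `ρ̄(σ) ≠ 1`.
[cite: ConradDiamondTaylor1999, Introduction (p. 522) and proof of Thm. 7.1.2 (p. 556)] -/
theorem exists_mem_absUpperRamificationSubgroup_ne_one_of_dvd_conductorNorm
    (W : WeierstrassCurve ℚ) [W.IsElliptic]
    (hOgg : W.artinConductorExponent_tate_eq_conductorExponent_of_isElliptic 5)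
    {ρ : GaloisRepresentations.ModPGaloisRep ℚ (ZMod 5) 2} (hρ : W.IsTorsionGaloisRep 5 ρ)
    (h27 : 27 ∣ W.conductorNorm ℤ) :
    ∃ v : HeightOneSpectrum (𝓞 ℚ), ((3 : ℕ) : 𝓞 ℚ) ∈ v.asIdeal ∧ ∃ 𝔓 ∈ v.primesAbove,
      ∃ u : ℝ, 0 < u ∧
        ∃ σ ∈ GaloisRepresentations.absUpperRamificationSubgroup (𝓞 ℚ) 𝔓 u, ρ σ ≠ 1 := by
  classical
  -- the places above `3`
  set p3 : Nat.Primes := ⟨3, Nat.prime_three⟩ with hp3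
  set vZ : HeightOneSpectrum ℤ := (Rat.HeightOneSpectrum.primesEquiv (R := ℤ)).symm p3 with hvZ
  set v : HeightOneSpectrum (𝓞 ℚ) := (Rat.HeightOneSpectrum.primesEquiv (R := 𝓞 ℚ)).symm p3
    with hv
  have h3v : ((3 : ℕ) : 𝓞 ℚ) ∈ v.asIdeal := by
    rw [EllipticCurves.natCast_mem_asIdeal_iff_eq_primesEquiv_symm v Nat.prime_three]
  -- `f₃(E) ≥ 3`
  have hfZ : 3 ≤ W.conductorExponent vZ := by
    have hfac := factorization_conductorNorm_holds W vZ
    have hgen : Rat.HeightOneSpectrum.natGenerator vZ = 3 := by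
      change ((Rat.HeightOneSpectrum.primesEquiv vZ : Nat.Primes) : ℕ) = 3
      rw [hvZ, Equiv.apply_symm_apply]
    rw [hgen] at hfac
    rw [← hfac, ← Nat.Prime.pow_dvd_iff_le_factorization Nat.prime_three
      (conductorNorm_pos_holds W).ne']
    norm_num
    exact h27
  have hf : 3 ≤ W.conductorExponent v := by
    rw [conductorExponent_ringOfIntegers_eq W v, hv, Equiv.apply_symm_apply]
    exact hfZ
  -- `a₃(V₅ E) ≥ 3`
  have hcont : Continuous fun x : absoluteGaloisGroup ℚ × EllipticCurves.RationalTateModule (geomPoints W) 5 ↦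
      EllipticCurves.rationalTateRepresentation (absoluteGaloisGroup ℚ) (geomPoints W) 5 x.1 x.2 :=
    continuous_rationalGaloisRepTate_holds W 5
  have h5 : ((5 : ℕ) : 𝓞 ℚ) ∉ v.asIdeal := by
    rw [EllipticCurves.natCast_mem_asIdeal_iff_eq_primesEquiv_symm v Nat.prime_five, hv,
      (Rat.HeightOneSpectrum.primesEquiv (R := 𝓞 ℚ)).symm.injective.eq_iff]
    intro h
    have := congrArg Subtype.val h
    norm_num [hp3] at this
  have ha : EllipticCurves.conductorExponentOf (geomPoints W) 5 hcont v = W.conductorExponent v :=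
    hOgg hcont v h5
  set ρV := EllipticCurves.rationalTateGaloisRepOf (geomPoints W) 5 hcont with hρV
  haveI : Module.Finite ℚ_[5] (EllipticCurves.RationalTateModule (geomPoints W) 5) :=
    module_finite_rationalTateModule_holds W 5
  have hrank : Module.finrank ℚ_[5] (EllipticCurves.RationalTateModule (geomPoints W) 5) = 2 :=
    finrank_rationalTateModule_eq_two_holds W 5 (by norm_num)
  have ha3 : Module.finrank ℚ_[5] (EllipticCurves.RationalTateModule (geomPoints W) 5) <
      ρV.artinConductorExponent v := by
    rw [hrank]
    change 2 < EllipticCurves.conductorExponentOf (geomPoints W) 5 hcont v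
    rw [ha]
    exact hf
  -- a wild element acting non-trivially on `V₅ E`
  obtain ⟨u, hu, σ, hσu, hσV⟩ := exists_mem_absUpperRamificationSubgroup_ne_one ρV v ha3
  set 𝔓 := (HeightOneSpectrum.primesAbove_nonempty v).some with h𝔓def
  have h𝔓 : 𝔓 ∈ v.primesAbove := (HeightOneSpectrum.primesAbove_nonempty v).some_mem
  refine ⟨v, h3v, 𝔓, h𝔓, u, hu, σ, hσu, ?_⟩
  -- it moves a point of `E[5ⁿ]`
  obtain ⟨n, x, hn⟩ := exists_smul_proj_ne_of_ne_one W 5 hσV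
  set P : geomPoints W := EllipticCurves.TateModule.proj 5 n x with hPdef
  have hP : 5 ^ n • P = 0 :=
    AddSubgroup.torsionBy.nsmul_iff.mp (proj_tateModule_mem_geomTorsion W 5 n x)
  -- the action of `σ` on the finite `Γ_ℚ`-set `E[5ⁿ]` (open stabiliser) has `3`-power order
  set M := geomTorsion W ((5 ^ n : ℕ) : ℤ) with hM
  haveI : Finite M :=
    finite_torsionPoints_holds W (AlgebraicClosure ℚ) (n := ((5 ^ n : ℕ) : ℤ)) (by positivity)
  have hopen : IsOpen {τ : absoluteGaloisGroup ℚ | ∀ Q : M, τ • Q = Q} := by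
    have hset : {τ : absoluteGaloisGroup ℚ | ∀ Q : M, τ • Q = Q} =
        ⋂ Q : M, (MulAction.stabilizer (absoluteGaloisGroup ℚ) (Q : geomPoints W) : Set _) := by
      ext τ
      simp only [Set.mem_setOf_eq, Set.mem_iInter, SetLike.mem_coe, MulAction.mem_stabilizer_iff,
        Subtype.ext_iff]
      rfl
    rw [hset]
    exact isOpen_iInter_of_finite fun Q ↦ isOpen_stabilizer_point_holds W (Q : geomPoints W)
  obtain ⟨k, hk⟩ := exists_pow_prime_pow_smul_eq_self h𝔓 h3v hu hσu M hopen
  have hN : ∀ a : geomPoints W, 5 ^ n • a = 0 → σ ^ 3 ^ k • a = a := fun a ha ↦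
    congrArg Subtype.val (hk ⟨a, AddSubgroup.torsionBy.nsmul_iff.mpr ha⟩)
  -- hence `σ` already moves a point of `E[5]`
  obtain ⟨P₁, hP₁5, hσP₁⟩ : ∃ P₁ : geomPoints W, 5 • P₁ = 0 ∧ σ • P₁ ≠ P₁ := by
    by_contra hall
    simp only [not_exists, not_and, not_not] at hall
    have hcop : (3 ^ k).Coprime 5 := Nat.Coprime.pow_left k (by norm_num)
    exact hn (smul_eq_self_of_pow_smul_eq_self_of_coprime hcop hall hN P hP)
  -- so `ρ̄(σ) ≠ 1`
  intro h1
  apply hσP₁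
  obtain ⟨e, he⟩ := hρ
  have h2 := he σ ⟨P₁, AddSubgroup.torsionBy.nsmul_iff.mpr hP₁5⟩
  rw [h1, Units.val_one, one_mulVec] at h2
  exact congrArg Subtype.val (e.injective h2)

open WeierstrassCurve in
/-- **`ρ̄_{E,5}` tamely ramified above `3` ⇒ `27 ∤ N_E`**, granted Ogg–Saito in Galois form at
`ℓ = 5` (`hOgg`): for an elliptic curve `E / ℚ` and any framed model `ρ̄` of `E[5]` which is
tamely ramified above `3` (`FramedGaloisRep.IsTamelyRamifiedAbove 3`), the conductor `N_E` is not
divisible by `27` — so that CDT Thm. 7.2.1 / 7.1.2 apply ("`E` acquires semistable reduction over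
a tamely ramified extension of `ℚ₃`", CDT 1999, Introduction p. 522; BCDT 2001, Introduction and
§2.2, case 1). Contrapositive of
`exists_mem_absUpperRamificationSubgroup_ne_one_of_dvd_conductorNorm`.
[cite: ConradDiamondTaylor1999, Introduction (p. 522)] -/
theorem not_dvd_conductorNorm_of_isTamelyRamifiedAbove (W : WeierstrassCurve ℚ) [W.IsElliptic]
    (hOgg : W.artinConductorExponent_tate_eq_conductorExponent_of_isElliptic 5)
    {ρ : GaloisRepresentations.ModPGaloisRep ℚ (ZMod 5) 2} (hρ : W.IsTorsionGaloisRep 5 ρ)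
    (htame : ρ.IsTamelyRamifiedAbove 3) : ¬ 27 ∣ W.conductorNorm ℤ := by
  intro h27
  obtain ⟨v, hv, 𝔓, h𝔓, u, hu, σ, hσ, hne⟩ :=
    exists_mem_absUpperRamificationSubgroup_ne_one_of_dvd_conductorNorm W hOgg hρ h27
  exact hne (htame v hv 𝔓 h𝔓 u hu σ hσ)

/-! ## The printed inputs of BCDT Theorem 2.2.1 (= Theorem B), as named facts -/

section Facts

open EllipticCurves.ModularForms WeierstrassCurve

/-- **Conrad–Diamond–Taylor 1999, Theorem 7.2.1** (JAMS 12 (1999), p. 553): "Let `E/ℚ` be an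
elliptic curve such that `ρ̄_{E,3}|_{ℚ(√-3)}` is absolutely irreducible. If the conductor of `E` is
not divisible by `27`, then `E` is modular." This is the theorem BCDT invoke in case 1 of the proof
of Thm. 2.2.1 (§2.2: "In the first case, `E` is modular by Theorem 7.2.1 of [CDT]"). Conventions
word for word as in `CDT_theorem_7_2_2` / `CDT_theorem_7_1_2` (`BCDTModularity`, Part 4): `E` is an
elliptic Weierstrass model `W / ℚ` with conductor `N_E = W.conductorNorm ℤ` (the instance
`NeZero (W.conductorNorm ℤ)` holds by `WeierstrassCurve.conductorNorm_pos_holds`), `ρ̄_{E,3}` is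
any framed `ρ̄ : Γ_ℚ →ₜ* GL₂(𝔽₃)` with `W.IsTorsionGaloisRep 3 ρ̄` (all are conjugate),
"`ρ̄_{E,3}|_{ℚ(√-3)}` absolutely irreducible" is `IsAbsIrreducibleOverSqrt (-3) ρ̄` (every model of
the splitting field of `X² + 3`), and "`E` is modular" is `Literature.NumberTheory.Automorphic.BCDT.IsModular W` (BCDT,
Introduction, condition (2)). CDT call it "the following weaker version of Theorem 7.1.2" — indeed
`CDT_theorem_7_1_2` (no irreducibility hypothesis) implies it (`CDT_theorem_7_2_1_of_7_1_2`); CDT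
prove 7.2.1 first (Langlands–Tunnell for `ρ̄_{E,3}`; Diamond 1996 Thm. 5.4 if a quadratic twist is
semistable at `3`; otherwise their Thm. 7.1.1 at `ℓ = 3` with `τ = ω̃₂² ⊕ ω̃₂⁶`, Lemma 7.1.3,
§B.2, Prop. B.4.2, Cor. 2.3.2) and deduce 7.1.2 from it, Lemma 7.2.3 (Elkies) and Thm. 7.2.2;
not in Mathlib. [cite: ConradDiamondTaylor1999, Thm. 7.2.1] -/
def CDT_theorem_7_2_1 : Prop :=
  ∀ (W : WeierstrassCurve ℚ) [W.IsElliptic] [NeZero (W.conductorNorm ℤ)]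
    (ρ : GaloisRepresentations.ModPGaloisRep ℚ (ZMod 3) 2), W.IsTorsionGaloisRep 3 ρ →
    ρ.IsAbsIrreducibleOverSqrt (-3) → ¬ 27 ∣ W.conductorNorm ℤ → IsModular W

/-- CDT Thm. 7.1.2 ("`27 ∤ N_E` ⇒ `E` modular", `CDT_theorem_7_1_2` of `BCDTModularity` Part 4)
implies its "weaker version" Thm. 7.2.1 (CDT, p. 553) by forgetting the hypothesis on `ρ̄_{E,3}`
(sanity check of the conventions; it also lets every assembly below run on the input
`CDT_theorem_7_1_2` already in the trust base of Theorem A). [folklore] -/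
theorem CDT_theorem_7_2_1_of_7_1_2 (h : CDT_theorem_7_1_2) : CDT_theorem_7_2_1 :=
  fun W _ _ _ _ _ h27 ↦ h W h27

/-- **The auxiliary elliptic curve of the `3`–`5` switch** (Breuil–Conrad–Diamond–Taylor 2001,
§2.2, proof of Thm. 2.2.1, third step: "Using Ekedahl's version of the Hilbert
Irreducibility Theorem (see Theorem 1.3 of [E]) and the argument of §1 of [SBT] we may find an
elliptic curve `E/ℚ` and an `𝔽₅[G_ℚ]`-module isomorphism of `ρ̄` with `E[5](ℚ̄)` such that … the
representation `ρ̄_{E,3}` of `G_ℚ` on `E[3](ℚ̄)` is surjective onto `Aut(E[3](ℚ̄))` …"; Introduction: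
"Using the technique of Minkowski and Klein (i.e. the observation that the moduli space of
elliptic curves with full level `5` structure has genus `0` …), Hilbert irreducibility and some
local computations of Manoharmayum [Man], we find an elliptic curve `E/ℚ` with the following
properties: `ρ̄_{E,5} ≅ ρ̄`, `ρ̄_{E,3}` is surjective onto `GL₂(𝔽₃)`, and [conditions at `3`]").
Vendored WITHOUT the conditions at `3` (which need `3`-adic Hodge types): for every continuous,
absolutely irreducible `ρ̄ : Γ_ℚ →ₜ* GL₂(𝔽₅)` with cyclotomic determinant there is an elliptic
curve `E / ℚ` (an elliptic Weierstrass model `W`) with `E[5] ≅ ρ̄` as `𝔽₅[Γ_ℚ]`-modules — i.e.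
`ρ̄` itself is a framed model of `E[5]`, `W.IsTorsionGaloisRep 5 ρ̄` — and with `ρ̄_{E,3}`
surjective: some (equivalently every, all being conjugate) framed model `ρ̄₃ : Γ_ℚ →ₜ* GL₂(𝔽₃)`
of `E[3]` is onto. The existence of `E` with `E[5] ≅ ρ̄` for every such `ρ̄` is Shepherd-Barron–
Taylor, *Mod 2 and mod 5 icosahedral representations*, JAMS 10 (1997), §1 (the twist `X(ρ̄)` of
`X(5) ≅ ℙ¹` is a rational curve; quoted in this form by Dieulefait 2004, p. 3, and by Taylor,
*Icosahedral Galois representations*, Pacific J. Math. (1997), p. 344: "One finds an elliptic curve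
`E/ℚ` which realises `ρ₀` on its `5` division points … Using Hilbert irreducibility we may ensure
(following Wiles) that the representation of `G_ℚ` on `E[3]` has image `GL₂(𝔽₃)`"; cf.
Manoharmayum, MRL 6 (1999), Thm. A (c)). BCDT state it after a quadratic twist normalising
`ρ̄|_{G₃}`; both conclusions are invariant under quadratic twists `E ↦ E^{(d)}`. Not in Mathlib
(no modular curves `X(5)`, no Hilbert irreducibility).
[cite: BCDTJAMS2001, §2.2 (proof of Thm. 2.2.1, third step) and Introduction] -/
def exists_isTorsionGaloisRep_five_and_surjective_three : Prop :=
  ∀ ρ : GaloisRepresentations.ModPGaloisRep ℚ (ZMod 5) 2,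
    GaloisRepresentations.FramedRep.IsAbsolutelyIrreducible ρ →
    (∀ σ : absoluteGaloisGroup ℚ,
      Matrix.GeneralLinearGroup.det (ρ σ) = GaloisRepresentations.modPCyclotomicCharacterZMod ℚ 5 σ) →
    ∃ (W : WeierstrassCurve ℚ) (_ : W.IsElliptic), W.IsTorsionGaloisRep 5 ρ ∧
      ∃ ρ₃ : GaloisRepresentations.ModPGaloisRep ℚ (ZMod 3) 2,
        W.IsTorsionGaloisRep 3 ρ₃ ∧ Function.Surjective ρ₃

/-- **BCDT Theorem 2.2.1, the wild case** (Breuil–Conrad–Diamond–Taylor 2001, §2.2, proof of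
Thm. 2.2.1, cases 2–6; Introduction, the cases `f = 27, 81, 243`; this is the content of
§§3–9 of the paper). For a continuous, absolutely irreducible `ρ̄ : Γ_ℚ →ₜ* GL₂(𝔽₅)` with
cyclotomic determinant which is NOT tamely ramified above `3` (some wild ramification group
`Γ_ℚ^u(𝔓)`, `u > 0`, `𝔓 ∣ 3`, acts non-trivially: `¬ IsTamelyRamifiedAbove 3 ρ̄`; BCDT: up to a
quadratic twist `ρ̄|_{G₃}` is one of the five wild shapes 2–6 of §2.2), there is an elliptic curve
`E / ℚ` with `E[5] ≅ ρ̄` (`W.IsTorsionGaloisRep 5 ρ̄`) which is modular (`Literature.NumberTheory.Automorphic.BCDT.IsModular W`,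
BCDT Introduction, condition (2)). Printed proof: choose `E₁/ℚ₃` with `E₁[5] ≅ ρ̄|_{G₃}` and
`E₁[3]|_{I₃}` of the prescribed très ramifié shape (Manoharmayum 1999, Thm. 5.3.2 and §5.4;
Cor. 2.3.2); by [SBT] §1 and Ekedahl's Hilbert irreducibility get `E/ℚ` with `E[5] ≅ ρ̄`
(compatibly with the Weil pairing), `ρ̄_{E,3}` surjective and `E[3]|_{G₃} ≅ E₁[3]|_{G₃}`; by CDT
Prop. B.4.2, `ρ_{E,3}|_{G₃}` is potentially Barsotti–Tate of type `τ_{±1}`, `τ_{±3}` or extended type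
`τ'_i`; `ρ̄_{E,3}(G₃)` has centraliser `𝔽₃`, `τ` admits `ρ̄_{E,3}` (Lemmas 2.1.1, 2.1.3, 2.1.5) and is
weakly acceptable for it (Thms. 2.1.2, 2.1.4, 2.1.6, proved in §§4–9 via Breuil modules);
`ρ̄_{E,3}|_{ℚ(√-3)}` is absolutely irreducible and `ρ̄_{E,3}` is modular by Langlands–Tunnell; so
`ρ_{E,3}` is modular by Thms. 1.4.1–1.4.2, "We deduce that `E` is modular". A quadratic twist
`E ↦ E^{(d)}` undoes BCDT's normalisation of `ρ̄|_{G₃}` (modularity of `E` and `E[5] ≅ ρ̄ ⊗ χ_d` are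
twist-compatible). None of the ingredients (`3`-adic Hodge types, "admits", "weakly acceptable",
the deformation-theoretic `R = T` theorems) is in Mathlib; this named fact is exactly what remains
of Theorem B after the tame case and the last step are proved in this file.
[cite: BCDTJAMS2001, §2.2 (proof of Thm. 2.2.1, cases 2–6)] -/
def exists_isTorsionGaloisRep_and_isModular_of_not_isTamelyRamifiedAbove : Prop :=
  ∀ ρ : GaloisRepresentations.ModPGaloisRep ℚ (ZMod 5) 2,
    GaloisRepresentations.FramedRep.IsAbsolutelyIrreducible ρ →
    (∀ σ : absoluteGaloisGroup ℚ,
      Matrix.GeneralLinearGroup.det (ρ σ) = GaloisRepresentations.modPCyclotomicCharacterZMod ℚ 5 σ) →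
    ¬ ρ.IsTamelyRamifiedAbove 3 →
    ∃ (W : WeierstrassCurve ℚ) (_ : W.IsElliptic) (_ : NeZero (W.conductorNorm ℤ)),
      W.IsTorsionGaloisRep 5 ρ ∧ IsModular W

end Facts

/-! ## Assembly: Theorem 2.2.1 = Theorem B from the printed inputs -/

section Assembly

open EllipticCurves.ModularForms WeierstrassCurve

/-- **BCDT Theorem 2.2.1, the tame case, PROVED from its printed inputs** (§2.2, proof of
Thm. 2.2.1, case 1: "`ρ̄` is tamely ramified at `3` … In the first case, `E` is modular by Theorem
7.2.1 of [CDT]"; equally Taylor 1997, p. 344). Granted the auxiliary curve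
(`exists_isTorsionGaloisRep_five_and_surjective_three`), CDT Thm. 7.2.1 (`CDT_theorem_7_2_1`) and
Ogg–Saito in Galois form at `ℓ = 5` for every `E / ℚ` (`hOgg`, the tree's named fact): for a
continuous, absolutely irreducible `ρ̄ : Γ_ℚ →ₜ* GL₂(𝔽₅)` with cyclotomic determinant, tamely
ramified above `3`, there is an elliptic curve `E / ℚ` with `E[5] ≅ ρ̄` which is modular. Proof:
take `E` with `E[5] ≅ ρ̄` and `ρ̄_{E,3}` surjective; `E[5] ≅ ρ̄` is tame above `3`, so `27 ∤ N_E`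
(`not_dvd_conductorNorm_of_isTamelyRamifiedAbove`); `ρ̄_{E,3}|_{ℚ(√-3)}` is absolutely irreducible
(`isAbsIrreducibleOverSqrt_neg_three_of_surjective`); hence `E` is modular by CDT Thm. 7.2.1.
[cite: BCDTJAMS2001, §2.2 (proof of Thm. 2.2.1, case 1)] -/
theorem exists_isTorsionGaloisRep_and_isModular_of_isTamelyRamifiedAbove
    (hE : exists_isTorsionGaloisRep_five_and_surjective_three) (h721 : CDT_theorem_7_2_1)
    (hOgg : ∀ W : WeierstrassCurve ℚ,
      W.artinConductorExponent_tate_eq_conductorExponent_of_isElliptic 5)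
    (ρ : GaloisRepresentations.ModPGaloisRep ℚ (ZMod 5) 2)
    (hirr : GaloisRepresentations.FramedRep.IsAbsolutelyIrreducible ρ)
    (hdet : ∀ σ : absoluteGaloisGroup ℚ,
      Matrix.GeneralLinearGroup.det (ρ σ) = GaloisRepresentations.modPCyclotomicCharacterZMod ℚ 5 σ)
    (htame : ρ.IsTamelyRamifiedAbove 3) :
    ∃ (W : WeierstrassCurve ℚ) (_ : W.IsElliptic) (_ : NeZero (W.conductorNorm ℤ)),
      W.IsTorsionGaloisRep 5 ρ ∧ IsModular W := by
  obtain ⟨W, hW, hρ, ρ₃, hρ₃, hsurj⟩ := hE ρ hirr hdet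
  haveI : NeZero (W.conductorNorm ℤ) := ⟨(conductorNorm_pos_holds W).ne'⟩
  exact ⟨W, hW, inferInstance, hρ,
    h721 W ρ₃ hρ₃ (isAbsIrreducibleOverSqrt_neg_three_of_surjective ρ₃ hsurj)
      (not_dvd_conductorNorm_of_isTamelyRamifiedAbove W (hOgg W) hρ htame)⟩

/-- **BCDT §2.2, proof of Thm. 2.2.1, everything but its last sentence**: granted the wild case
(`exists_isTorsionGaloisRep_and_isModular_of_not_isTamelyRamifiedAbove`), the auxiliary curve,
CDT Thm. 7.2.1 and Ogg–Saito at `ℓ = 5`, every continuous absolutely irreducible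
`ρ̄ : Γ_ℚ →ₜ* GL₂(𝔽₅)` with cyclotomic determinant is `E[5]` for a modular elliptic curve `E / ℚ`
(case distinction tame / wild above `3`; the tame case is the previous theorem).
[cite: BCDTJAMS2001, §2.2 (proof of Thm. 2.2.1)] -/
theorem exists_isTorsionGaloisRep_and_isModular
    (hW : exists_isTorsionGaloisRep_and_isModular_of_not_isTamelyRamifiedAbove)
    (hE : exists_isTorsionGaloisRep_five_and_surjective_three) (h721 : CDT_theorem_7_2_1)
    (hOgg : ∀ W : WeierstrassCurve ℚ,
      W.artinConductorExponent_tate_eq_conductorExponent_of_isElliptic 5)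
    (ρ : GaloisRepresentations.ModPGaloisRep ℚ (ZMod 5) 2)
    (hirr : GaloisRepresentations.FramedRep.IsAbsolutelyIrreducible ρ)
    (hdet : ∀ σ : absoluteGaloisGroup ℚ,
      Matrix.GeneralLinearGroup.det (ρ σ) = GaloisRepresentations.modPCyclotomicCharacterZMod ℚ 5 σ) :
    ∃ (W : WeierstrassCurve ℚ) (_ : W.IsElliptic) (_ : NeZero (W.conductorNorm ℤ)),
      W.IsTorsionGaloisRep 5 ρ ∧ IsModular W := by
  by_cases htame : ρ.IsTamelyRamifiedAbove 3
  · exact exists_isTorsionGaloisRep_and_isModular_of_isTamelyRamifiedAbove hE h721 hOgg ρ hirr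
      hdet htame
  · exact hW ρ hirr hdet htame

/-- **The last sentence of the proof of BCDT Thm. 2.2.1** ("We deduce that `E` is modular, so
`ρ̄ ≅ ρ̄_{E,5}` is modular"), as an implication between statements about all `ρ̄`: if every
continuous absolutely irreducible `ρ̄ : Γ_ℚ →ₜ* GL₂(𝔽₅)` with cyclotomic determinant is `E[5]` for
some modular elliptic curve `E / ℚ`, then Theorem B (`theoremB`) holds. The implication
"`E` modular ⇒ `ρ̄_{E,5}` modular" is the tree's theorem
`IsModular.isModular_of_isTorsionGaloisRep'` (`BCDTModularityModPProofs`: Diamond–Shurman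
Thm. 9.4.1 read modulo `5`), whose last input, the trace of Frobenius on `T₅ E` (Silverman *AEC*
V.2.3.1 / C.21.3), is the tree's theorem
`WeierstrassCurve.trace_galoisRepTate_frobenius_of_hasGoodReductionAt_holds`
(`HasseWeilGoodReductionProofs`); so this step is unconditional.
[cite: BCDTJAMS2001, §2.2 (proof of Thm. 2.2.1, last step)] -/
theorem theoremB_of_exists_isTorsionGaloisRep_and_isModular
    (h : ∀ ρ : GaloisRepresentations.ModPGaloisRep ℚ (ZMod 5) 2,
      GaloisRepresentations.FramedRep.IsAbsolutelyIrreducible ρ →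
      (∀ σ : absoluteGaloisGroup ℚ,
        Matrix.GeneralLinearGroup.det (ρ σ) =
          GaloisRepresentations.modPCyclotomicCharacterZMod ℚ 5 σ) →
      ∃ (W : WeierstrassCurve ℚ) (_ : W.IsElliptic) (_ : NeZero (W.conductorNorm ℤ)),
        W.IsTorsionGaloisRep 5 ρ ∧ IsModular W) :
    theoremB := by
  intro ρ hirr hdet
  obtain ⟨W, _, _, hρ, hmod⟩ := h ρ hirr hdet
  exact hmod.isModular_of_isTorsionGaloisRep'
    (W.trace_galoisRepTate_frobenius_of_hasGoodReductionAt_holds 5) hρ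

/-- **BCDT Theorem B = Theorem 2.2.1 from its printed inputs** (JAMS 14 (2001), §2.2): Theorem B
(`Literature.NumberTheory.Automorphic.BCDT.theoremB`) follows from (i) the wild case
(`exists_isTorsionGaloisRep_and_isModular_of_not_isTamelyRamifiedAbove`, BCDT §§3–9 with
Thms. 1.4.1–1.4.2, 2.1.2–2.1.6, Langlands–Tunnell), (ii) the auxiliary curve of the `3`–`5` switch
(`exists_isTorsionGaloisRep_five_and_surjective_three`, [SBT] §1 + Hilbert irreducibility),
(iii) CDT Thm. 7.2.1 (`CDT_theorem_7_2_1`) and (iv) Ogg–Saito in Galois form at `ℓ = 5`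
(`artinConductorExponent_tate_eq_conductorExponent_of_isElliptic · 5`), everything else — the
tame case, the case distinction, "`E` modular ⇒ `ρ̄_{E,5}` modular" — being proved in the tree.
This is the trust base of Theorem B inside the tree after this file.
[cite: BCDTJAMS2001, Theorem 2.2.1] -/
theorem theoremB_of_wild_of_auxiliaryCurve_of_CDT721
    (hW : exists_isTorsionGaloisRep_and_isModular_of_not_isTamelyRamifiedAbove)
    (hE : exists_isTorsionGaloisRep_five_and_surjective_three) (h721 : CDT_theorem_7_2_1)
    (hOgg : ∀ W : WeierstrassCurve ℚ,
      W.artinConductorExponent_tate_eq_conductorExponent_of_isElliptic 5) :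
    theoremB :=
  theoremB_of_exists_isTorsionGaloisRep_and_isModular
    (exists_isTorsionGaloisRep_and_isModular hW hE h721 hOgg)

/-- **Theorem B from the wild case, the auxiliary curve, CDT Thm. 7.1.2 and Ogg–Saito**: as
`theoremB_of_wild_of_auxiliaryCurve_of_CDT721`, with CDT Thm. 7.2.1 replaced by the stronger
Thm. 7.1.2 (`CDT_theorem_7_1_2`, already in the trust base of Theorem A through
`CDTModularityProofs`), via `CDT_theorem_7_2_1_of_7_1_2`. [cite: BCDTJAMS2001, Theorem 2.2.1] -/
theorem theoremB_of_wild_of_auxiliaryCurve_of_CDT712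
    (hW : exists_isTorsionGaloisRep_and_isModular_of_not_isTamelyRamifiedAbove)
    (hE : exists_isTorsionGaloisRep_five_and_surjective_three) (h712 : CDT_theorem_7_1_2)
    (hOgg : ∀ W : WeierstrassCurve ℚ,
      W.artinConductorExponent_tate_eq_conductorExponent_of_isElliptic 5) :
    theoremB :=
  theoremB_of_wild_of_auxiliaryCurve_of_CDT721 hW hE (CDT_theorem_7_2_1_of_7_1_2 h712) hOgg

/-- **BCDT Theorem A** (`Literature.NumberTheory.EllipticCurves.ModularForms.exists_isNewformOf`,
the Modularity Theorem in the tree's form) **with Theorem B unfolded one level**: from the wild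
case of Thm. 2.2.1, the auxiliary curve, CDT Thms. 7.1.2 and 7.2.2, and Ogg–Saito at `ℓ = 5`
(`exists_isNewformOf_of_theoremB_of_CDT712_722` of `CDTModularityProofs` with `theoremB`
discharged by `theoremB_of_wild_of_auxiliaryCurve_of_CDT712`). Trust base of the Modularity
Theorem in the tree after this file: {BCDT Thm. 2.2.1 cases 2–6, the [SBT] auxiliary curve,
CDT Thm. 7.1.2, CDT Thm. 7.2.2, Ogg–Saito for `V₅ E`}. [cite: BCDTJAMS2001, Theorem A] -/
theorem exists_isNewformOf_of_wild_of_auxiliaryCurve_of_CDT712_722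
    (hW : exists_isTorsionGaloisRep_and_isModular_of_not_isTamelyRamifiedAbove)
    (hE : exists_isTorsionGaloisRep_five_and_surjective_three) (h712 : CDT_theorem_7_1_2)
    (h722 : CDT_theorem_7_2_2)
    (hOgg : ∀ W : WeierstrassCurve ℚ,
      W.artinConductorExponent_tate_eq_conductorExponent_of_isElliptic 5) :
    EllipticCurves.ModularForms.exists_isNewformOf :=
  exists_isNewformOf_of_theoremB_of_CDT712_722
    (theoremB_of_wild_of_auxiliaryCurve_of_CDT712 hW hE h712 hOgg) h712 h722 hOgg

end Assembly

end Literature.NumberTheory.Automorphic.BCDT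

/-! ## Part 2 (appended): Theorem B as on p. 843; the API of `IsTamelyRamifiedAbove`; the
tame cases `f = 1, 3, 9` of the Introduction -/

namespace Literature.NumberTheory.Automorphic.BCDT

/-! ### Theorem B as printed on p. 843: "irreducible" versus "absolutely irreducible" -/

/-- **An odd irreducible `ρ̄ : Γ_ℚ → GL₂(𝔽₅)` is absolutely irreducible** — the case needed
here of the tree's general theorem
`Literature.NumberTheory.GaloisRepresentations.FramedRep.isAbsolutelyIrreducible_of_isIrreducible_of_det_eq_neg_one`
(`OddAbsolutelyIrreducibleProofs`: over a field with `2 ≠ 0`, an irreducible framed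
`ρ : G →ₜ* GL₂(A)` containing an involution of determinant `-1` is absolutely irreducible;
Darmon–Diamond–Taylor 1995, p. 87). If `ρ̄ : Γ_ℚ →ₜ* GL₂(𝔽₅)` has cyclotomic determinant then a
complex conjugation `c` (`exists_isComplexConjugation`) is such an involution:
`c² = 1` and `det ρ̄(c) = χ̄₅(c) = -1` (`modNCyclotomicCharacter_of_isComplexConjugation`), and
`2 ≠ 0` in `𝔽₅`. This is the remark reconciling Theorem B as printed on p. 843 of BCDT
("irreducible") with Theorem 2.2.1 ("absolutely irreducible"), see the docstring of `theoremB`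
and `theoremB_iff_of_isIrreducible`. [folklore] -/
theorem isAbsolutelyIrreducible_of_isIrreducible_of_det_eq
    (ρ : GaloisRepresentations.ModPGaloisRep ℚ (ZMod 5) 2)
    (hdet : ∀ σ : absoluteGaloisGroup ℚ,
      Matrix.GeneralLinearGroup.det (ρ σ) = GaloisRepresentations.modPCyclotomicCharacterZMod ℚ 5 σ)
    (hirr : GaloisRepresentations.FramedRep.IsIrreducible ρ) :
    GaloisRepresentations.FramedRep.IsAbsolutelyIrreducible ρ := by
  obtain ⟨c, hc⟩ := GaloisRepresentations.exists_isComplexConjugation (Rat.castHom ℝ)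
  have hcc : c * c = 1 := by rw [← pow_two]; exact hc.sq_eq_one
  refine GaloisRepresentations.FramedRep.isAbsolutelyIrreducible_of_isIrreducible_of_det_eq_neg_one
    ρ hirr (by decide) hcc ?_
  rw [hdet c, GaloisRepresentations.modPCyclotomicCharacterZMod_eq_modNCyclotomicCharacter]
  ext
  simpa using GaloisRepresentations.modNCyclotomicCharacter_of_isComplexConjugation (N := 5) hc

/-- **Theorem B as printed on p. 843 ⟺ Theorem 2.2.1 as vendored.** BCDT print Theorem B in the
Introduction with "irreducible" ("If `ρ̄ : Gal(ℚ̄/ℚ) → GL₂(𝔽₅)` is an irreducible continuous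
representation with cyclotomic determinant, then `ρ̄` is modular") and Theorem 2.2.1 with
"absolutely irreducible"; the two are equivalent statements, because an odd irreducible
`ρ̄ : Γ_ℚ → GL₂(𝔽₅)` is absolutely irreducible
(`isAbsolutelyIrreducible_of_isIrreducible_of_det_eq`) and conversely
(`FramedRep.IsAbsolutelyIrreducible.isIrreducible`). [cite: BCDTJAMS2001, Theorem B] -/
theorem theoremB_iff_of_isIrreducible :
    theoremB ↔
      ∀ ρ : GaloisRepresentations.ModPGaloisRep ℚ (ZMod 5) 2,
        GaloisRepresentations.FramedRep.IsIrreducible ρ →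
        (∀ σ : absoluteGaloisGroup ℚ,
          Matrix.GeneralLinearGroup.det (ρ σ) =
            GaloisRepresentations.modPCyclotomicCharacterZMod ℚ 5 σ) →
        ρ.IsModular :=
  ⟨fun h ρ hirr hdet ↦ h ρ (isAbsolutelyIrreducible_of_isIrreducible_of_det_eq ρ hdet hirr) hdet,
    fun h ρ habs hdet ↦ h ρ habs.isIrreducible hdet⟩

/-! ### API of `IsTamelyRamifiedAbove` -/

/-- Tame ramification above `p` is invariant under change of frame
(`Literature.NumberTheory.GaloisRepresentations.FramedRep.conj`; all framed models of a given
Galois module, e.g. of `E[5]`, are conjugate). [folklore] -/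
theorem _root_.Literature.NumberTheory.GaloisRepresentations.FramedGaloisRep.isTamelyRamifiedAbove_conj_iff
    {K : Type*} [Field K] [NumberField K] {A : Type*} [CommRing A] [TopologicalSpace A]
    [IsTopologicalRing A] {n : ℕ} (p : ℕ) (P : GL (Fin n) A)
    (ρ : GaloisRepresentations.FramedGaloisRep K A n) :
    GaloisRepresentations.FramedGaloisRep.IsTamelyRamifiedAbove p
        (GaloisRepresentations.FramedRep.conj P ρ) ↔ ρ.IsTamelyRamifiedAbove p := by
  refine forall₂_congr fun v _ ↦ forall₂_congr fun 𝔓 _ ↦ forall₂_congr fun u _ ↦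
    forall₂_congr fun σ _ ↦ ?_
  rw [GaloisRepresentations.FramedRep.conj_apply, mul_inv_eq_one, mul_eq_left]

/-- **Inertia of order prime to `p` ⇒ tamely ramified above `p`** (the form in which BCDT's
Introduction phrases the tame cases: "`ρ̄(I₃)` has order `5`", "order `4`", resp. "`ρ̄` is
unramified at `3`" — the cases `f = 3, 9, 1`). For a framed representation `ρ : Γ_K →ₜ* GL_n(A)`
over a discrete ring `A` and a rational prime `p`: if for every `𝔓 ∣ p` the image `ρ(I_𝔓)` of
inertia is a finite group of order prime to `p`, then `ρ` is tamely ramified above `p`. Proof: an element `σ`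
of `Γ_K^u(𝔓)`, `u > 0`, lies in `I_𝔓` (`absUpperRamificationSubgroup_le_inertia_holds`), so the
order of `ρ(σ)` divides `#ρ(I_𝔓)`; and `ρ(σ)` has `p`-power order, since the action of `σ` on the
discrete `Γ_K`-set `GL_n(A)` (through `ρ`, open stabiliser `ker ρ`) factors through a finite Galois
group in which `σ` lands in `G₁`, a `p`-group (`exists_pow_prime_pow_smul_eq_self`,
`CDTModularityProofs`; Serre, *Corps locaux* IV §2 Cor. 3). [folklore] -/
theorem _root_.Literature.NumberTheory.GaloisRepresentations.FramedGaloisRep.isTamelyRamifiedAbove_of_coprime_card_map_inertia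
    {K : Type*} [Field K] [NumberField K] {A : Type*} [CommRing A] [TopologicalSpace A]
    [DiscreteTopology A] {n : ℕ} {p : ℕ} (ρ : GaloisRepresentations.FramedGaloisRep K A n)
    (h : ∀ v : HeightOneSpectrum (𝓞 K), (p : 𝓞 K) ∈ v.asIdeal → ∀ 𝔓 ∈ v.primesAbove,
      (Nat.card ((𝔓.inertia (absoluteGaloisGroup K)).map ρ.toMonoidHom)).Coprime p) :
    ρ.IsTamelyRamifiedAbove p := by
  classical
  intro v hv 𝔓 h𝔓 u hu σ hσ
  -- `ρ σ` lies in the finite group `ρ(I_𝔓)` of order prime to `p`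
  have hσI : σ ∈ 𝔓.inertia (absoluteGaloisGroup K) :=
    GaloisRepresentations.absUpperRamificationSubgroup_le_inertia_holds (𝓞 K) 𝔓 u (K := K) hσ
  have hmem : ρ σ ∈ (𝔓.inertia (absoluteGaloisGroup K)).map ρ.toMonoidHom :=
    Subgroup.mem_map_of_mem _ hσI
  have hdvd : orderOf (ρ σ) ∣ Nat.card ((𝔓.inertia (absoluteGaloisGroup K)).map ρ.toMonoidHom) :=
    Subgroup.orderOf_dvd_natCard _ hmem
  -- `ρ σ` has `p`-power order: `σ` acts on the discrete `Γ_K`-set `GL_n(A)` through `ρ`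
  letI : MulAction (absoluteGaloisGroup K) (GL (Fin n) A) := MulAction.compHom _ ρ.toMonoidHom
  have hopen : IsOpen {τ : absoluteGaloisGroup K | ∀ x : GL (Fin n) A, τ • x = x} := by
    have hset : {τ : absoluteGaloisGroup K | ∀ x : GL (Fin n) A, τ • x = x} = ρ ⁻¹' {1} := by
      ext τ
      simp only [Set.mem_setOf_eq, Set.mem_preimage, Set.mem_singleton_iff]
      constructor
      · intro hτ
        have h1 := hτ 1
        change ρ τ * 1 = 1 at h1
        rwa [mul_one] at h1
      · intro hτ x
        change ρ τ * x = x
        rw [hτ, one_mul]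
    rw [hset]
    exact (isOpen_discrete _).preimage (map_continuous ρ)
  obtain ⟨k, hk⟩ := exists_pow_prime_pow_smul_eq_self h𝔓 hv hu hσ (GL (Fin n) A) hopen
  have hpow : (ρ σ) ^ p ^ k = 1 := by
    have h1 := hk 1
    change ρ (σ ^ p ^ k) * 1 = 1 at h1
    rwa [mul_one, map_pow] at h1
  -- so its order divides `gcd(#ρ(I_𝔓), p^k) = 1`
  have hdvd' : orderOf (ρ σ) ∣ p ^ k := orderOf_dvd_of_pow_eq_one hpow
  have hone : orderOf (ρ σ) = 1 :=
    Nat.dvd_one.mp <| by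
      have := Nat.dvd_gcd hdvd hdvd'
      rwa [Nat.Coprime.gcd_eq_one ((h v hv 𝔓 h𝔓).pow_right k)] at this
  exact orderOf_eq_one_iff.mp hone

/-- **Tameness of `E[n]` does not depend on the frame**: for a framed model `ρ̄` of the `n`-torsion
of a Weierstrass curve `W` over a number field (`W.IsTorsionGaloisRep n ρ̄`), `ρ̄` is tamely
ramified above `p` iff every wild ramification group `Γ_K^u(𝔓)`, `u > 0`, `𝔓 ∣ p`, fixes
`E[n](K̄)` pointwise — a property of the Galois module `E[n]` alone (BCDT: "`ρ̄_{E,5}` … tamely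
ramified"). Deliberate dot-notation extension of the tree's `WeierstrassCurve.IsTorsionGaloisRep`
(Mathlib's `WeierstrassCurve` namespace). [folklore] -/
theorem _root_.WeierstrassCurve.IsTorsionGaloisRep.isTamelyRamifiedAbove_iff {K : Type u} [Field K]
    [NumberField K] {W : WeierstrassCurve K} {n : ℕ}
    {ρ : GaloisRepresentations.FramedGaloisRep K (ZMod n) 2} (hρ : W.IsTorsionGaloisRep n ρ)
    (p : ℕ) :
    ρ.IsTamelyRamifiedAbove p ↔
      ∀ v : HeightOneSpectrum (𝓞 K), (p : 𝓞 K) ∈ v.asIdeal → ∀ 𝔓 ∈ v.primesAbove,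
        ∀ u : ℝ, 0 < u → ∀ σ ∈ GaloisRepresentations.absUpperRamificationSubgroup (𝓞 K) 𝔓 u,
          ∀ P : WeierstrassCurve.geomTorsion W n, σ • P = P := by
  refine forall₂_congr fun v _ ↦ forall₂_congr fun 𝔓 _ ↦ forall₂_congr fun u _ ↦
    forall₂_congr fun σ _ ↦ ⟨fun h P ↦ ?_, fun h ↦ hρ.eq_one_of_forall_smul_eq h⟩
  obtain ⟨e, he⟩ := hρ
  apply e.injective
  rw [he σ P, h, Units.val_one, one_mulVec]

/-! ### The tame cases `f = 1, 3, 9` of BCDT's Introduction -/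

section TameCases

open EllipticCurves.ModularForms WeierstrassCurve

/-- **The case `f = 1` of BCDT's Introduction** ("`ρ̄` is unramified at `3` … This was carried out
in [Di2] in the cases `f = 1` and `f = 3`, and in [CDT] in the case `f = 9`"): the tame-case
theorem specialised to `ρ̄` unramified at (the place above) `3`
(`isTamelyRamifiedAbove_of_isUnramifiedAt`). Same inputs as
`exists_isTorsionGaloisRep_and_isModular_of_isTamelyRamifiedAbove`.
[cite: BCDTJAMS2001, Introduction (case f = 1)] -/
theorem exists_isTorsionGaloisRep_and_isModular_of_isUnramifiedAt
    (hE : exists_isTorsionGaloisRep_five_and_surjective_three) (h721 : CDT_theorem_7_2_1)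
    (hOgg : ∀ W : WeierstrassCurve ℚ,
      W.artinConductorExponent_tate_eq_conductorExponent_of_isElliptic 5)
    (ρ : GaloisRepresentations.ModPGaloisRep ℚ (ZMod 5) 2)
    (hirr : GaloisRepresentations.FramedRep.IsAbsolutelyIrreducible ρ)
    (hdet : ∀ σ : absoluteGaloisGroup ℚ,
      Matrix.GeneralLinearGroup.det (ρ σ) = GaloisRepresentations.modPCyclotomicCharacterZMod ℚ 5 σ)
    (hunr : ∀ v : HeightOneSpectrum (𝓞 ℚ), ((3 : ℕ) : 𝓞 ℚ) ∈ v.asIdeal → ρ.IsUnramifiedAt v) :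
    ∃ (W : WeierstrassCurve ℚ) (_ : W.IsElliptic) (_ : NeZero (W.conductorNorm ℤ)),
      W.IsTorsionGaloisRep 5 ρ ∧ IsModular W :=
  exists_isTorsionGaloisRep_and_isModular_of_isTamelyRamifiedAbove hE h721 hOgg ρ hirr hdet
    (GaloisRepresentations.FramedGaloisRep.isTamelyRamifiedAbove_of_isUnramifiedAt hunr)

/-- **The cases `f = 3, 9` of BCDT's Introduction** ("`ρ̄(I₃)` has order `5`", "`ρ̄(I₃)` has order
`4`"; more generally any `ρ̄` whose inertia images `ρ̄(I_𝔓)`, `𝔓 ∣ 3`, have order prime to `3`):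
the tame-case theorem via `isTamelyRamifiedAbove_of_coprime_card_map_inertia`.
[cite: BCDTJAMS2001, Introduction (cases f = 3, 9)] -/
theorem exists_isTorsionGaloisRep_and_isModular_of_coprime_card_map_inertia
    (hE : exists_isTorsionGaloisRep_five_and_surjective_three) (h721 : CDT_theorem_7_2_1)
    (hOgg : ∀ W : WeierstrassCurve ℚ,
      W.artinConductorExponent_tate_eq_conductorExponent_of_isElliptic 5)
    (ρ : GaloisRepresentations.ModPGaloisRep ℚ (ZMod 5) 2)
    (hirr : GaloisRepresentations.FramedRep.IsAbsolutelyIrreducible ρ)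
    (hdet : ∀ σ : absoluteGaloisGroup ℚ,
      Matrix.GeneralLinearGroup.det (ρ σ) = GaloisRepresentations.modPCyclotomicCharacterZMod ℚ 5 σ)
    (h3 : ∀ v : HeightOneSpectrum (𝓞 ℚ), ((3 : ℕ) : 𝓞 ℚ) ∈ v.asIdeal → ∀ 𝔓 ∈ v.primesAbove,
      (Nat.card ((𝔓.inertia (absoluteGaloisGroup ℚ)).map ρ.toMonoidHom)).Coprime 3) :
    ∃ (W : WeierstrassCurve ℚ) (_ : W.IsElliptic) (_ : NeZero (W.conductorNorm ℤ)),
      W.IsTorsionGaloisRep 5 ρ ∧ IsModular W :=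
  exists_isTorsionGaloisRep_and_isModular_of_isTamelyRamifiedAbove hE h721 hOgg ρ hirr hdet
    (GaloisRepresentations.FramedGaloisRep.isTamelyRamifiedAbove_of_coprime_card_map_inertia ρ h3)

end TameCases

/-! ## Part 3 (appended): the Langlands–Tunnell step of §2.2 for the auxiliary curve -/

section LanglandsTunnellStep

/-- **BCDT §2.2, p. 862, for a curve with `ρ̄_{E,3}` surjective: "`ρ̄_{E,3}|_{Gal(ℚ̄/ℚ(√-3))}` is
absolutely irreducible and, by the Langlands–Tunnell theorem (see [Wi]), modular"** — PROVED
granted the Langlands–Tunnell theorem (`langlands_tunnell`, for every `σ : Γ_ℚ → GL₂(ℂ)`).  For an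
elliptic curve `E / ℚ` and a framed model `ρ̄₃` of `E[3]` which is onto `GL₂(𝔽₃)`: the first clause
is `isAbsIrreducibleOverSqrt_neg_three_of_surjective` (Part 1), the second is
`WeierstrassCurve.isModular_of_isTorsionGaloisRep_three_of_langlands_tunnell`
(`LanglandsTunnellModThree`: Wiles 1995, Ch. 5; Gelbart 1997, Prop. 1.4, Steps 1–3), applied to
the absolute irreducibility of `ρ̄₃` over `ℚ` that the first clause implies
(`IsAbsIrreducibleOverSqrt.isAbsolutelyIrreducible`).  "Modular" is BCDT's notion
`ModPGaloisRep.IsModular` (an eigenform of some weight `≥ 1`; here the weight-one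
Langlands–Tunnell form). [cite: BCDTJAMS2001, §2.2, proof of Thm. 2.2.1 (p. 862)] -/
theorem isAbsIrreducibleOverSqrt_and_isModular_three_of_surjective
    (hLT : ∀ σ : GaloisRepresentations.FramedArtinRep ℚ 2, langlands_tunnell σ)
    (W : WeierstrassCurve ℚ) [W.IsElliptic] (ρ₃ : GaloisRepresentations.ModPGaloisRep ℚ (ZMod 3) 2)
    (h₃ : W.IsTorsionGaloisRep 3 ρ₃) (hsurj : Function.Surjective ρ₃) :
    ρ₃.IsAbsIrreducibleOverSqrt (-3) ∧ ρ₃.IsModular :=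
  have habs := isAbsIrreducibleOverSqrt_neg_three_of_surjective ρ₃ hsurj
  ⟨habs, W.isModular_of_isTorsionGaloisRep_three_of_langlands_tunnell hLT ρ₃ h₃
    habs.isAbsolutelyIrreducible⟩

/-- **The auxiliary curve of §2.2 with the Langlands–Tunnell step performed.**  Granted the
Shepherd-Barron–Taylor existence fact (`exists_isTorsionGaloisRep_five_and_surjective_three`) and
the Langlands–Tunnell theorem (`langlands_tunnell`), every continuous, absolutely irreducible
`ρ̄ : Γ_ℚ → GL₂(𝔽₅)` with cyclotomic determinant is `E[5]` of an elliptic curve `E / ℚ`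
(`W.IsTorsionGaloisRep 5 ρ̄`) admitting a framed `ρ̄_{E,3}` which is surjective, absolutely
irreducible on `Γ_{ℚ(√-3)}` and modular — the hypotheses on `ρ̄_{E,3}` under which BCDT then
invoke Thms. 1.4.1–1.4.2 (wild cases) or CDT Thm. 7.2.1 (tame case), the remaining `3`-adic type
conditions being inside `exists_isTorsionGaloisRep_and_isModular_of_not_isTamelyRamifiedAbove` and
`CDT_theorem_7_2_1`.  (BCDT, §2.2, proof of Thm. 2.2.1: "`ρ̄_{E,3}` is surjective onto `GL₂(𝔽₃)` …
absolutely irreducible and, by the Langlands–Tunnell theorem, modular.")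
[cite: BCDTJAMS2001, §2.2, proof of Thm. 2.2.1 (p. 862)] -/
theorem exists_auxiliaryCurve_and_isModular_three
    (hE : exists_isTorsionGaloisRep_five_and_surjective_three)
    (hLT : ∀ σ : GaloisRepresentations.FramedArtinRep ℚ 2, langlands_tunnell σ)
    (ρ : GaloisRepresentations.ModPGaloisRep ℚ (ZMod 5) 2)
    (habs : GaloisRepresentations.FramedRep.IsAbsolutelyIrreducible ρ)
    (hdet : ∀ σ : absoluteGaloisGroup ℚ,
      Matrix.GeneralLinearGroup.det (ρ σ) = GaloisRepresentations.modPCyclotomicCharacterZMod ℚ 5 σ) :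
    ∃ (W : WeierstrassCurve ℚ) (_ : W.IsElliptic), W.IsTorsionGaloisRep 5 ρ ∧
      ∃ ρ₃ : GaloisRepresentations.ModPGaloisRep ℚ (ZMod 3) 2,
        W.IsTorsionGaloisRep 3 ρ₃ ∧ Function.Surjective ρ₃ ∧
          ρ₃.IsAbsIrreducibleOverSqrt (-3) ∧ ρ₃.IsModular := by
  obtain ⟨W, hW, h5, ρ₃, h₃, hsurj⟩ := hE ρ habs hdet
  exact ⟨W, hW, h5, ρ₃, h₃, hsurj,
    isAbsIrreducibleOverSqrt_and_isModular_three_of_surjective hLT W ρ₃ h₃ hsurj⟩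

end LanglandsTunnellStep

end Literature.NumberTheory.Automorphic.BCDT

end
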